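import Summits.CriticalPhenomena.PercolationContinuityZ3.Theorems.Transplant.TiltedSectorArms
import Summits.CriticalPhenomena.PercolationContinuityZ3.Theorems.Transplant.TiltedSectorLink
import HarnessLib

/-!
# The slab cut by a planar sector strictly inside a quadrant: the STATION DESIGN for uniqueness of the infinite cluster (tilted arms, far station)

builds on p205010 (kernel theorem, internal audit signed; external expert review pending) — NOT used in this file.
Lane `prim-bschramm`, seat `prim-bschramm-p2` (gen 24; class C1b, METHOD = input substitution; memo `HOME/bschramm/P2-LATTICES.md` §86);
helper file (`--supports stmt-CriticalPhenomena-4575 --as helper`).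

THE DESIGN (domain `𝕋𝕊 = {x ∈ S_k | s₁x₁ ≤ x₂ ≤ s₂x₁}`, `0 < s₁ < s₂`, `s₁ ≤ 2`; box `[-N,N]³`).  Inner-boundary vertices `u` sit on the top face
(`u₁ = N`, apex `b = u + e₁`) or on the right face (`u₂ = N`, apex `b = u + e₂`) — never on the bottom or left face (§1).  ARM at the apex `b`: if `b`
is at least `H` above the lower edge (`b₂ - s₁b₁ ≥ H`) the downward-fattened tilted arm `b + 𝔸↓` (inside `𝕋𝕊` by `σ₁ ≥ s₁`, `σ₂ ≤ s₂`; off the box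
because `𝔸↓` never goes below its apex's row), otherwise (`b` is then `≥ H` below the upper edge) the upward-fattened arm `b + 𝔸↑`.  STATION
`Ω = (0, Y, ⌈s₁Y⌉)` far to the right (`Y ≫ N`) with its shallow slope-`2` cone up to `Z = ⌊s₂Y⌋` (inside `𝕋𝕊` since `s₁ ≤ 2`), right end
`T = Y + (Z - ⌈s₁Y⌉)`.  Beyond the abscissa `Y` every arm point lies in the strip `[⌈s₁Y⌉, Z]` (below: because it lies in `𝕋𝕊`; above: because the
arm climbs at slope `≤ σ₂ < s₂/(1 + s₂ - s₁)`, hypothesis `hfit`), so the FAR-STATION link (`move_apex_cyl_far`) applies: on "arm reaches `{x₁ = T}`"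
∩ "station reaches `{x₂ = Z}`" (Harris, `P ≥ α·A.α`) at most `k + 1` extra edges join `u` to `Ω` through exterior open steps.
* §1 `tsec_cyl`, `tsec_innerBdry`; §2 **`tsec_vertex_design`** (all size constraints as explicit hypotheses; the sequel `TiltedSectorUniqueness` chooses
  `σ₁, σ₂, H, Y(N), M(N)` and discharges them).
[cite: AizenmanChayesChayesFrohlichRusso1983, §4 Thm 4.4, Lemma 4.2 (a), Lemma 4.3] [cite: DuminilCopinSidoraviciusTassion2016, Thm. 1 and §2]
[cite: GrimmettPercolation1999, §8.3 Thm (8.8) p. 202] -/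

noncomputable section

namespace Summit.CriticalPhenomena.PercolationContinuityZ3.Theorems.Transplant

namespace TiltSector

open MeasureTheory Literature.Probability.Percolation Literature.Probability.LatticeModels SimpleGraph HSU OrthantUniq HalfSlabUniq RationalHalfSlab
open scoped Classical

variable {k N : ℕ} {s₁ s₂ : ℝ}

/-! ## §1 The domain: cylindrical, inner boundary on the top and right faces only -/

/-- The tilted sector-slab is cylindrical in the slab coordinate. [folklore] -/
theorem tsec_cyl : ∀ x ∈ {x : Site 3 | x ∈ slab 3 k ∧ (s₁ * (x 1 : ℝ) ≤ (x 2 : ℝ) ∧ (x 2 : ℝ) ≤ s₂ * (x 1 : ℝ))}, ∀ y ∈ slab 3 k,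
    y 1 = x 1 → y 2 = x 2 → y ∈ {x : Site 3 | x ∈ slab 3 k ∧ (s₁ * (x 1 : ℝ) ≤ (x 2 : ℝ) ∧ (x 2 : ℝ) ≤ s₂ * (x 1 : ℝ))} := by
  intro x hx y hy h1 h2
  exact ⟨hy, by rw [h1, h2]; exact hx.2⟩

/-- **Inner boundary of `[-N,N]³` in the tilted sector-slab** (`0 < s₁ < s₂`, `N ≥ k+1`): top face `u₁ = N` with `u + e₁` in the domain, or right
face `u₂ = N` with `u + e₂` in the domain — never the bottom or left face (`x₁, x₂ ≥ 0` in the domain). [cite: AizenmanChayesChayesFrohlichRusso1983, §4 (4.26)] -/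
theorem tsec_innerBdry (hs : s₁ < s₂) (hs₁ : 0 < s₁) (hN : k + 1 ≤ N) {u : Site 3} (hu : u ∈ boxSet 3 N)
    (hw : ∃ w, w ∉ boxSet 3 N ∧
      (withinGraph (zdGraph 3) {x : Site 3 | x ∈ slab 3 k ∧ (s₁ * (x 1 : ℝ) ≤ (x 2 : ℝ) ∧ (x 2 : ℝ) ≤ s₂ * (x 1 : ℝ))}).Adj u w) :
    u ∈ {x : Site 3 | x ∈ slab 3 k ∧ (s₁ * (x 1 : ℝ) ≤ (x 2 : ℝ) ∧ (x 2 : ℝ) ≤ s₂ * (x 1 : ℝ))} ∧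
      ((u 1 = N ∧ u + Pi.single 1 1 ∈ {x : Site 3 | x ∈ slab 3 k ∧ (s₁ * (x 1 : ℝ) ≤ (x 2 : ℝ) ∧ (x 2 : ℝ) ≤ s₂ * (x 1 : ℝ))}) ∨
       (u 2 = N ∧ u + Pi.single 2 1 ∈ {x : Site 3 | x ∈ slab 3 k ∧ (s₁ * (x 1 : ℝ) ≤ (x 2 : ℝ) ∧ (x 2 : ℝ) ≤ s₂ * (x 1 : ℝ))})) := by
  obtain ⟨huD, hface⟩ := innerBdry_faces tsec_subset_slab hN hu hw
  refine ⟨huD, ?_⟩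
  rcases hface with h | h | ⟨h, hD⟩ | ⟨h, hD⟩
  · exact Or.inl h
  · exact Or.inr h
  · exfalso
    have h2 := (nonneg_of_mem_tsec hs hs₁ hD).2
    simp only [Pi.sub_apply, Pi.single_eq_same] at h2
    omega
  · exfalso
    have h1 := (nonneg_of_mem_tsec hs hs₁ hD).1
    simp only [Pi.sub_apply, Pi.single_eq_same] at h1
    omega

/-! ## §2 The design -/

/-- **THE DESIGN AT AN INNER-BOUNDARY VERTEX OF THE TILTED SECTOR-SLAB.**  Data: slopes `0 < s₁ < s₂`, `s₁ ≤ 2`; arm slopes `s₁ ≤ σ₁ ≤ σ₂ ≤ s₂`, `σ₂ ≥ 0`,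
fattening `H` with `(s₂ - s₁)·b₁ ≥ 2H` at every apex (`hbig₁`, `hbig₂`); station abscissa `Y ≥ N+1`, `Ω₂ = ⌈s₁Y⌉ ≤ Z = ⌊s₂Y⌋`, right end
`T = Y + (Z - Ω₂)`, the fit `(s₂-σ₂)(N+1) + σ₂T + H + 1 ≤ s₂Y`; window `M ≥ N, T, s₂T`; arm bounds `α` for `b + 𝔸↑`, `b + 𝔸↓` and a slab arm kit `A` at
`p'`.  Conclusion: an increasing measurable event determined by the edges of `[-M,M]³`, of `P_{p'} ≥ α·A.α`, on which `≤ k + 1` extra open edges of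
`[-M,M]³` join `u` to the station `Ω = (0, Y, Ω₂)` through open exterior steps of the domain.
[cite: AizenmanChayesChayesFrohlichRusso1983, §4 Cor. to Lemma 4.3, Lemma 4.2 (a)] -/
theorem tsec_vertex_design (hs : s₁ < s₂) (hs₁ : 0 < s₁) (hs2 : s₁ ≤ 2) {σ₁ σ₂ : ℝ} (hσ₁ : s₁ ≤ σ₁) (hσ : σ₁ ≤ σ₂) (hσ₂ : σ₂ ≤ s₂)
    {H : ℕ} (hN : k + 1 ≤ N) (hbig₁ : 2 * (H : ℝ) ≤ (s₂ - s₁) * ((N : ℝ) + 1)) (hbig₂ : 2 * (H : ℝ) * s₂ ≤ (s₂ - s₁) * ((N : ℝ) + 1))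
    {Y Ω₂ Z T : ℤ} (hY : (N : ℤ) + 1 ≤ Y) (hΩ₂ : Ω₂ = ⌈s₁ * (Y : ℝ)⌉) (hZ : Z = ⌊s₂ * (Y : ℝ)⌋) (hΩZ : Ω₂ ≤ Z) (hT : T = Y + (Z - Ω₂))
    (hfit : (s₂ - σ₂) * ((N : ℝ) + 1) + σ₂ * (T : ℝ) + H + 1 ≤ s₂ * (Y : ℝ))
    {M : ℕ} (hMN : N ≤ M) (hMT : T ≤ (M : ℤ)) (hMs : s₂ * (T : ℝ) ≤ M)
    {p' : unitInterval} (A : SlabArmKit k p') {α : ℝ} (hα : 0 < α)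
    (harmU : ∀ b : Site 3, b ∈ slab 3 k →
      α ≤ (bondPercolation (zdGraph 3) p').real (percolatesVia (withinGraph (zdGraph 3) (armUpAt k σ₁ σ₂ H b)) b))
    (harmD : ∀ b : Site 3, b ∈ slab 3 k →
      α ≤ (bondPercolation (zdGraph 3) p').real (percolatesVia (withinGraph (zdGraph 3) (armDnAt k σ₁ σ₂ H b)) b))
    {u : Site 3} (hu : u ∈ boxSet 3 N)
    (hw : ∃ w, w ∉ boxSet 3 N ∧
      (withinGraph (zdGraph 3) {x : Site 3 | x ∈ slab 3 k ∧ (s₁ * (x 1 : ℝ) ≤ (x 2 : ℝ) ∧ (x 2 : ℝ) ≤ s₂ * (x 1 : ℝ))}).Adj u w) :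
    ∃ E : Set (BondConfig (Site 3)), IsUpperSet E ∧ MeasurableSet E ∧ DeterminedBy E ↑(edgesIn (zdGraph 3) (box 3 M)) ∧
      α * A.α ≤ (bondPercolation (zdGraph 3) p').real E ∧
      ∀ ω ∈ E, ∃ F : Finset (Sym2 (Site 3)), F ⊆ edgesIn (zdGraph 3) (box 3 M) ∧ F.card ≤ k + 1 ∧
        ω ∪ ↑F ∈ openConnVia (starGraph (withinGraph (zdGraph 3)
          {x : Site 3 | x ∈ slab 3 k ∧ (s₁ * (x 1 : ℝ) ≤ (x 2 : ℝ) ∧ (x 2 : ℝ) ≤ s₂ * (x 1 : ℝ))}) Set.univ (boxSet 3 N)) u ![0, Y, Ω₂] := by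
  obtain ⟨huD, hface⟩ := tsec_innerBdry hs hs₁ hN hu hw
  have hub := mem_boxSet_iff.1 hu
  have hs₂ : 0 < s₂ := hs₁.trans hs
  have hσ0 : 0 ≤ σ₁ := hs₁.le.trans hσ₁
  have hσ20 : 0 ≤ σ₂ := hσ0.trans hσ
  have hH0 : (0 : ℝ) ≤ H := by positivity
  have hYr : (N : ℝ) + 1 ≤ (Y : ℝ) := by exact_mod_cast hY
  have hΩ₂lo : s₁ * (Y : ℝ) ≤ (Ω₂ : ℝ) := by rw [hΩ₂]; exact Int.le_ceil _
  have hZhi : (Z : ℝ) ≤ s₂ * (Y : ℝ) := by rw [hZ]; exact Int.floor_le _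
  have hΩZr : (Ω₂ : ℝ) ≤ (Z : ℝ) := by exact_mod_cast hΩZ
  have hYT : Y ≤ T := by rw [hT]; linarith
  have hYTr : (Y : ℝ) ≤ (T : ℝ) := by exact_mod_cast hYT
  have hY0 : (0 : ℝ) ≤ (Y : ℝ) := by linarith [(show (0 : ℝ) ≤ (N : ℝ) by positivity)]
  have hΩ₂0 : (0 : ℝ) ≤ Ω₂ := le_trans (mul_nonneg hs₁.le hY0) hΩ₂lo
  have hkN : k ≤ N := by omega
  set D : Set (Site 3) := {x : Site 3 | x ∈ slab 3 k ∧ (s₁ * (x 1 : ℝ) ≤ (x 2 : ℝ) ∧ (x 2 : ℝ) ≤ s₂ * (x 1 : ℝ))} with hD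
  set Ω : Site 3 := ![0, Y, Ω₂] with hΩ_def
  have hΩ0 : Ω 0 = 0 := by simp [hΩ_def]
  have hΩ1 : Ω 1 = Y := by simp [hΩ_def]
  have hΩ2' : Ω 2 = Ω₂ := by simp [hΩ_def]
  have hΩslab : Ω ∈ slab 3 k := by show 0 ≤ Ω 0 ∧ Ω 0 ≤ (k : ℤ); rw [hΩ0]; exact ⟨le_rfl, by positivity⟩
  -- window: every point of `D` below `{x₁ ≤ T}` lies in `[-M, M]³`
  have win : ∀ x ∈ D, x 1 ≤ T → ∀ j, |x j| ≤ (M : ℤ) := by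
    intro x hx hxT j
    obtain ⟨hx1, hx2⟩ := nonneg_of_mem_tsec hs hs₁ hx
    obtain ⟨⟨h00, h0k⟩, -, hup⟩ := hx
    have hxTr : (x 1 : ℝ) ≤ (T : ℝ) := by exact_mod_cast hxT
    have e1 : s₂ * (x 1 : ℝ) ≤ s₂ * (T : ℝ) := mul_le_mul_of_nonneg_left hxTr hs₂.le
    have hx2M : (x 2 : ℝ) ≤ M := by linarith
    have hx2M' : x 2 ≤ (M : ℤ) := by exact_mod_cast hx2M
    fin_cases j
    · rw [abs_le]; constructor <;> simp <;> omega
    · rw [abs_le]; constructor <;> simp <;> omega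
    · rw [abs_le]; constructor <;> simp <;> omega
  -- the station's shallow region: in `D`, off the box, below `{x₁ ≤ T}`
  have hH : ∀ x ∈ shallowReg k Ω Z, x ∈ D ∧ x ∉ boxSet 3 N ∧ x 1 ≤ T := by
    intro x hx
    obtain ⟨h0, h1, h2, h3, h4⟩ := shallowReg_props hx
    rw [hΩ1] at h1 h2; rw [hΩ2'] at h2 h3
    have h1r : (Y : ℝ) ≤ (x 1 : ℝ) := by exact_mod_cast h1
    have h2r : 2 * ((x 1 : ℝ) - Y) ≤ (x 2 : ℝ) - Ω₂ := by exact_mod_cast h2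
    have h4r : (x 2 : ℝ) ≤ (Z : ℝ) := by exact_mod_cast h4
    have e1 : s₁ * ((x 1 : ℝ) - Y) ≤ 2 * ((x 1 : ℝ) - Y) := mul_le_mul_of_nonneg_right hs2 (by linarith)
    have e2 : s₂ * (Y : ℝ) ≤ s₂ * (x 1 : ℝ) := mul_le_mul_of_nonneg_left h1r hs₂.le
    refine ⟨⟨h0, by linarith, by linarith⟩, not_mem_boxSet_of_lt (j := 1) (by rw [abs_of_nonneg (by omega)]; omega), by omega⟩
  have hwinH : ∀ x ∈ shallowReg k Ω Z, ∀ j, |x j| ≤ (M : ℤ) := fun x hx => win x (hH x hx).1 (hH x hx).2.2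
  -- generic packaging: an apex `b` adjacent to `u`, in `D` off the box with `b₁ ≤ N + 1`, and a steep region `S ∋ b` in the slab with the
  -- far-station properties and the arm bound `α`
  have pack : ∀ {b : Site 3} (_ : b ∈ D) (_ : (zdGraph 3).Adj u b) (_ : b ∉ boxSet 3 N) (_ : b 1 ≤ (N : ℤ) + 1) (S : Set (Site 3))
      (_ : S ⊆ slab 3 k) (_ : b ∈ S) (_ : ∀ x ∈ S, x ∈ D ∧ x ∉ boxSet 3 N ∧ x 1 ≤ T ∧ (Ω 1 ≤ x 1 → Ω 2 ≤ x 2 ∧ x 2 ≤ Z))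
      (_ : α ≤ (bondPercolation (zdGraph 3) p').real (reachEvent (withinGraph (zdGraph 3) S) b {x | x 1 = T})),
      ∃ E : Set (BondConfig (Site 3)), IsUpperSet E ∧ MeasurableSet E ∧ DeterminedBy E ↑(edgesIn (zdGraph 3) (box 3 M)) ∧
        α * A.α ≤ (bondPercolation (zdGraph 3) p').real E ∧
        ∀ ω ∈ E, ∃ F : Finset (Sym2 (Site 3)), F ⊆ edgesIn (zdGraph 3) (box 3 M) ∧ F.card ≤ k + 1 ∧
          ω ∪ ↑F ∈ openConnVia (starGraph (withinGraph (zdGraph 3) D) Set.univ (boxSet 3 N)) u Ω := by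
    intro b hbD hadj hbbox hb1 S hSslab hbS hS hprobS
    have hM : ∀ x ∈ S ∪ shallowReg k Ω Z, ∀ j, |x j| ≤ (M : ℤ) := by
      rintro x (hx | hx) j
      · exact win x (hS x hx).1 (hS x hx).2.2.1 j
      · exact hwinH x hx j
    have hprobH : A.α ≤ (bondPercolation (zdGraph 3) p').real
        (reachEvent (withinGraph (zdGraph 3) (shallowReg k Ω Z)) Ω {x | x 2 = Z}) :=
      le_real_of_subset (percolatesVia_subset_reachEvent_le (self_mem_shallowSet hΩslab) 2 (by rw [hΩ2']; exact hΩZ)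
        (by simpa only [HalfSlabUniq.shallowReg] using shallowReg_finite (k := k) Ω Z)) (A.shallow_arm Ω hΩslab)
    set E : Set (BondConfig (Site 3)) := reachEvent (withinGraph (zdGraph 3) S) b {x | x 1 = T} ∩
      reachEvent (withinGraph (zdGraph 3) (shallowReg k Ω Z)) Ω {x | x 2 = Z} with hE
    refine ⟨E, (isUpperSet_reachEvent _ _ _).inter (isUpperSet_reachEvent _ _ _),
      (measurableSet_reachEvent _ _ _).inter (measurableSet_reachEvent _ _ _), ?_, ?_, fun ω hω => ?_⟩
    · exact ((determinedBy_reachEvent _ _ _).mono (edgeSet_withinGraph_subset_edgesIn (subset_boxSet_of_abs_le fun x hx =>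
        hM x (Or.inl hx)))).inter ((determinedBy_reachEvent _ _ _).mono (edgeSet_withinGraph_subset_edgesIn
          (subset_boxSet_of_abs_le fun x hx => hM x (Or.inr hx))))
    · exact harris2_of_le p' (isUpperSet_reachEvent _ _ _) (isUpperSet_reachEvent _ _ _) (measurableSet_reachEvent _ _ _)
        (measurableSet_reachEvent _ _ _) hα.le hprobS hprobH
    · obtain ⟨F, hFs, hFc, hFr⟩ := move_apex_cyl_far (D := D) hkN tsec_cyl hSslab hbS hΩslab (by rw [hΩ2']; exact hΩZ)
        (by rw [hΩ1]; linarith) hS hH hM hω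
      have hwu : ∀ j, |u j| ≤ (M : ℤ) := abs_le_of_mem_boxSet hu hMN
      have hwb : ∀ j, |b j| ≤ (M : ℤ) := hM b (Or.inl hbS)
      refine ⟨insert s(u, b) F, ?_, (Finset.card_insert_le _ _).trans (by omega), ?_⟩
      · intro e he
        rcases Finset.mem_insert.1 he with rfl | he
        · exact mem_edgesIn_of_adj hadj hwu hwb
        · exact hFs he
      · exact openConnVia_step (dext_adj_of hadj huD hbD fun h' => hbbox h'.2) (Finset.mem_insert_self _ _)
          (openConnVia_mono_finset (Finset.subset_insert _ _) hFr)
  -- the apex `b` and its arm: `b ∈ D`, off the box through the face (`b₁ = N+1` or `b₂ = N+1`), `b₁ ≤ N+1`, `(s₂ - s₁) b₁ ≥ 2H`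
  have arm : ∀ {b : Site 3} (_ : b ∈ D) (_ : (zdGraph 3).Adj u b) (_ : b 1 = (N : ℤ) + 1 ∨ b 2 = (N : ℤ) + 1) (_ : b 1 ≤ (N : ℤ) + 1)
      (_ : 2 * (H : ℝ) ≤ (s₂ - s₁) * (b 1 : ℝ)),
      ∃ E : Set (BondConfig (Site 3)), IsUpperSet E ∧ MeasurableSet E ∧ DeterminedBy E ↑(edgesIn (zdGraph 3) (box 3 M)) ∧
        α * A.α ≤ (bondPercolation (zdGraph 3) p').real E ∧
        ∀ ω ∈ E, ∃ F : Finset (Sym2 (Site 3)), F ⊆ edgesIn (zdGraph 3) (box 3 M) ∧ F.card ≤ k + 1 ∧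
          ω ∪ ↑F ∈ openConnVia (starGraph (withinGraph (zdGraph 3) D) Set.univ (boxSet 3 N)) u Ω := by
    intro b hbD hadj hbface hb1 hbH
    obtain ⟨hbslab, hblo, hbhi⟩ := hbD
    obtain ⟨hb1nn, hb2nn⟩ := nonneg_of_mem_tsec hs hs₁ (show b ∈ D from ⟨hbslab, hblo, hbhi⟩)
    have hbbox : b ∉ boxSet 3 N := by
      rcases hbface with h | h
      · exact not_mem_boxSet_of_lt (j := 1) (by rw [h, abs_of_nonneg (by positivity)]; omega)
      · exact not_mem_boxSet_of_lt (j := 2) (by rw [h, abs_of_nonneg (by positivity)]; omega)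
    have hb1r : (b 1 : ℝ) ≤ (N : ℝ) + 1 := by exact_mod_cast hb1
    have hbT : b 1 ≤ T := by linarith
    -- the strip bound above: `(s₂ - σ₂) b₁ + σ₂ T + H ≤ s₂ Y - 1`, hence `≤ Z` after flooring
    have hstrip : ∀ (x : Site 3), b 1 ≤ x 1 → x 1 ≤ T → ((x 2 : ℝ) - b 2) ≤ σ₂ * ((x 1 : ℝ) - b 1) + H → x 2 ≤ Z := by
      intro x hx1 hxT hx2
      have hx1r : (b 1 : ℝ) ≤ (x 1 : ℝ) := by exact_mod_cast hx1
      have hxTr : (x 1 : ℝ) ≤ (T : ℝ) := by exact_mod_cast hxT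
      have e1 : σ₂ * ((x 1 : ℝ) - b 1) ≤ σ₂ * ((T : ℝ) - b 1) := mul_le_mul_of_nonneg_left (by linarith) hσ20
      have e2 : (s₂ - σ₂) * (b 1 : ℝ) ≤ (s₂ - σ₂) * ((N : ℝ) + 1) := mul_le_mul_of_nonneg_left hb1r (by linarith)
      have : (x 2 : ℝ) ≤ s₂ * (Y : ℝ) := by linarith
      rw [hZ]; exact Int.le_floor.2 this
    -- the strip bound below: points of `D` beyond `Y` are above `Ω₂ = ⌈s₁ Y⌉`
    have hlowstrip : ∀ x ∈ D, Y ≤ x 1 → Ω₂ ≤ x 2 := by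
      intro x hx hx1
      have hx1r : (Y : ℝ) ≤ (x 1 : ℝ) := by exact_mod_cast hx1
      have : s₁ * (Y : ℝ) ≤ (x 2 : ℝ) := le_trans (mul_le_mul_of_nonneg_left hx1r hs₁.le) hx.2.1
      rw [hΩ₂]; exact Int.ceil_le.2 this
    by_cases hlow : (H : ℝ) ≤ (b 2 : ℝ) - s₁ * (b 1 : ℝ)
    · -- DOWNWARD-fattened arm `b + 𝔸↓`
      set S : Set (Site 3) := armDnAt k σ₁ σ₂ H b ∩ {x | x 1 ≤ T} with hS_def
      have hbS : b ∈ S := ⟨self_mem_armDnAt hbslab, hbT⟩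
      have hSprops : ∀ x ∈ S, x ∈ D ∧ x ∉ boxSet 3 N ∧ x 1 ≤ T ∧ (Ω 1 ≤ x 1 → Ω 2 ≤ x 2 ∧ x 2 ≤ Z) := by
        rintro x ⟨hxA, hxT⟩
        have hxT' : x 1 ≤ T := hxT
        obtain ⟨hx0, ht1, ht2, hlo', hhi'⟩ := mem_armDnAt_iff.1 hxA
        have ht1r : (0 : ℝ) ≤ ((x 1 - b 1 : ℤ) : ℝ) := by exact_mod_cast ht1
        push_cast at hlo' hhi' ht1r
        have e1 : s₁ * ((x 1 : ℝ) - b 1) ≤ σ₁ * ((x 1 : ℝ) - b 1) := mul_le_mul_of_nonneg_right hσ₁ ht1r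
        have e2 : σ₂ * ((x 1 : ℝ) - b 1) ≤ s₂ * ((x 1 : ℝ) - b 1) := mul_le_mul_of_nonneg_right hσ₂ ht1r
        have hxD : x ∈ D := ⟨hx0, by linarith, by linarith⟩
        have hxbox : x ∉ boxSet 3 N := by
          rcases hbface with h | h
          · exact not_mem_boxSet_of_lt (j := 1) (by rw [abs_of_nonneg (by linarith)]; omega)
          · exact not_mem_boxSet_of_lt (j := 2) (by rw [abs_of_nonneg (by linarith)]; omega)
        refine ⟨hxD, hxbox, hxT', fun hx1 => ⟨?_, ?_⟩⟩
        · rw [hΩ2']; rw [hΩ1] at hx1; exact hlowstrip x hxD hx1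
        · exact hstrip x (by omega) hxT' (by linarith)
      have hSfin : S.Finite := (boxSet_finite _).subset (subset_boxSet_of_abs_le fun x hx =>
        win x (hSprops x hx).1 (hSprops x hx).2.2.1)
      have hprobS : α ≤ (bondPercolation (zdGraph 3) p').real (reachEvent (withinGraph (zdGraph 3) S) b {x | x 1 = T}) :=
        le_real_of_subset (percolatesVia_subset_reachEvent_le (self_mem_armDnAt hbslab) 1 hbT (by simpa [hS_def] using hSfin))
          (harmD b hbslab)
      exact pack ⟨hbslab, hblo, hbhi⟩ hadj hbbox hb1 S (fun x hx => armDnAt_subset_slab b hx.1) hbS hSprops hprobS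
    · -- UPWARD-fattened arm `b + 𝔸↑` (`b` is at least `H` below the upper edge)
      push Not at hlow
      have hup : (H : ℝ) ≤ s₂ * (b 1 : ℝ) - (b 2 : ℝ) := by linarith
      set S : Set (Site 3) := armUpAt k σ₁ σ₂ H b ∩ {x | x 1 ≤ T} with hS_def
      have hbS : b ∈ S := ⟨self_mem_armUpAt hbslab, hbT⟩
      have hSprops : ∀ x ∈ S, x ∈ D ∧ x ∉ boxSet 3 N ∧ x 1 ≤ T ∧ (Ω 1 ≤ x 1 → Ω 2 ≤ x 2 ∧ x 2 ≤ Z) := by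
        rintro x ⟨hxA, hxT⟩
        have hxT' : x 1 ≤ T := hxT
        obtain ⟨hx0, ht1, hlo', hhi'⟩ := mem_armUpAt_iff.1 hxA
        have ht1r : (0 : ℝ) ≤ ((x 1 - b 1 : ℤ) : ℝ) := by exact_mod_cast ht1
        push_cast at hlo' hhi' ht1r
        have e1 : s₁ * ((x 1 : ℝ) - b 1) ≤ σ₁ * ((x 1 : ℝ) - b 1) := mul_le_mul_of_nonneg_right hσ₁ ht1r
        have e2 : σ₂ * ((x 1 : ℝ) - b 1) ≤ s₂ * ((x 1 : ℝ) - b 1) := mul_le_mul_of_nonneg_right hσ₂ ht1r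
        have e3 : 0 ≤ σ₁ * ((x 1 : ℝ) - b 1) := mul_nonneg hσ0 ht1r
        have hxD : x ∈ D := ⟨hx0, by linarith, by linarith⟩
        have hx2b : b 2 ≤ x 2 := by
          have : (b 2 : ℝ) ≤ (x 2 : ℝ) := by linarith
          exact_mod_cast this
        have hxbox : x ∉ boxSet 3 N := by
          rcases hbface with h | h
          · exact not_mem_boxSet_of_lt (j := 1) (by rw [abs_of_nonneg (by linarith)]; omega)
          · exact not_mem_boxSet_of_lt (j := 2) (by rw [abs_of_nonneg (by linarith)]; omega)
        refine ⟨hxD, hxbox, hxT', fun hx1 => ⟨?_, ?_⟩⟩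
        · rw [hΩ2']; rw [hΩ1] at hx1; exact hlowstrip x hxD hx1
        · exact hstrip x (by omega) hxT' (by linarith)
      have hSfin : S.Finite := (boxSet_finite _).subset (subset_boxSet_of_abs_le fun x hx =>
        win x (hSprops x hx).1 (hSprops x hx).2.2.1)
      have hprobS : α ≤ (bondPercolation (zdGraph 3) p').real (reachEvent (withinGraph (zdGraph 3) S) b {x | x 1 = T}) :=
        le_real_of_subset (percolatesVia_subset_reachEvent_le (self_mem_armUpAt hbslab) 1 hbT (by simpa [hS_def] using hSfin))
          (harmU b hbslab)
      exact pack ⟨hbslab, hblo, hbhi⟩ hadj hbbox hb1 S (fun x hx => armUpAt_subset_slab b hx.1) hbS hSprops hprobS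
  -- the two faces
  rcases hface with ⟨htop, hbD⟩ | ⟨hright, hbD⟩
  · -- TOP face: `b = u + e₁`, `b₁ = N + 1`
    have hb1 : (u + Pi.single 1 1 : Site 3) 1 = (N : ℤ) + 1 := by simp [htop]
    refine arm hbD ((zdGraph_adj_iff _ _).2 ⟨1, Or.inl rfl⟩) (Or.inl hb1) hb1.le ?_
    rw [hb1]; push_cast; linarith
  · -- RIGHT face: `b = u + e₂`, `b₂ = N + 1`, `b₁ = u₁ ≤ N`, and `s₂ b₁ ≥ N + 1`
    have hb2 : (u + Pi.single 2 1 : Site 3) 2 = (N : ℤ) + 1 := by simp [hright]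
    have hb1 : (u + Pi.single 2 1 : Site 3) 1 = u 1 := by simp
    have hu1 := (hub 1).2
    refine arm hbD ((zdGraph_adj_iff _ _).2 ⟨2, Or.inl rfl⟩) (Or.inr hb2) (by rw [hb1]; omega) ?_
    have hhi := hbD.2.2
    rw [hb2, hb1] at hhi; push_cast at hhi
    rw [hb1]
    -- `s₂ u₁ ≥ N + 1` so `(s₂ - s₁) u₁ ≥ (s₂ - s₁)(N+1)/s₂ ≥ 2H`
    have hd : 0 ≤ s₂ - s₁ := by linarith
    have e1 : (s₂ - s₁) * ((N : ℝ) + 1) ≤ (s₂ - s₁) * (s₂ * (u 1 : ℝ)) := mul_le_mul_of_nonneg_left hhi hd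
    have e2 : 2 * (H : ℝ) * s₂ ≤ (s₂ - s₁) * (u 1 : ℝ) * s₂ := by linarith
    exact le_of_mul_le_mul_right e2 hs₂

end TiltSector

end Summit.CriticalPhenomena.PercolationContinuityZ3.Theorems.Transplant

end
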